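import Mathlib
import HarnessLib
import Summits.HubbardSuperconductivity.HubbardSuperconductivity.Theorems.KLProgrammeKLRegimeSplitTwoLegSizesMSChainTable
import Summits.HubbardSuperconductivity.HubbardSuperconductivity.Theorems.KLProgrammeKLRegimeSplitTwoLegSizesMSOfChain

/-!
# Route `KLProgramme`, crux K3 — gen-5 ENGINE child (stmt-…-19918, `stub_twoLeg_step`, clause `TwoLegSizesMST`), recipe (L)+(F):
# (E3a-MS) AT SCALE `n+1` FROM THE TERM TABLE ((P4-c), step 5)

Seat hubbard-kl-k3c3-p1 (g3).  `twoLegSizesMST_succ_of_chain_sizes` (the structural reduction, `…MSOfChain`) + the term table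
`msProfile_centred_sizes` / `abs_klAngularMean_msProfile_le` (`…MSChainTable`) + the chain curves `chain_curve_sizes` (`…MSChainCurves`):
`TwoLegSizesMST L M G Q R β U μ K (n+1)` follows from
* the piece decomposition `K = Σ_{m ≤ nScales β} Kp m` with frame-uniform piece sizes `‖Dʲ evalM (Kp m)‖ ≤ a m j` (`m ≤ nScales β`, `j ≤ 4`);
* the chain regime at base `n+1`: `chainSizeSum Kp a (n+1) (nScales β) j ≤ A` (`j ≤ 2`), `A ≤ 1/20`, `klCurveD ≤ Dt_min − 2A`, margins
  `−1.1 ≤ μ − A`, `μ + A ≤ −0.1`, `chainSizeSum … 3 ≤ A₃`, `chainSizeSum … 4 ≤ A₄`;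
* the increment symbol `S` of the scale step (`klLocalPart (n+1) − klLocalPart n = S ∘ k_F^K`, k3c3-p3) with sizes `|S| ≤ M 0`, `‖Dᵏ evalM S‖ ≤ M k` (`k ≤ 5`);
* ANY high-part sizes `e m j` of the deep pieces (`m ∈ Ioc (n+1) (nScales β)`; contraction or Jackson gain, `…MSPieceParts`);
* the two families of numerical fits (base: `[j=0]M₀ + C_j(X)·bellCum M msD j·c_j ≤ twoLegBar G Q U j (n+1)`; slot `m`:
  `[j=0]M₁·msdD₀(e m) + C_j(X)·bellDiffCum M msD (msdD (e m)) j·c_j ≤ msBar G Q U (n+1)·Gfr_j·uPow j U·4^{(j−2)m}`).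
Proofs only; nothing about the model.
-/

noncomputable section

namespace Summit.HubbardSuperconductivity.HubbardSuperconductivity.Theorems.KLRegimeSplit

set_option linter.dupNamespace false -- summit = problem name (single-conjunct summit), D-0017
set_option maxSynthPendingDepth 4 -- nested operator-norm instances (symbol sizes up to order five), as in `…CompDiff`

open Real Finset Literature.MathematicalPhysics.QuantumLattice Literature.MathematicalPhysics.QuantumLattice.FermiRG
open Literature.MathematicalPhysics.QuantumLattice.BandSectorCounting
open Summit.HubbardSuperconductivity.HubbardSuperconductivity.Theorems.KLProgrammeLegKernels
open Summit.HubbardSuperconductivity.HubbardSuperconductivity.Theorems.DispersionFlow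
open Summit.HubbardSuperconductivity.HubbardSuperconductivity.Theorems.PerturbedFermiCurve

section MS

variable {L M : ℕ} [NeZero L] [NeZero M] {G : GeoConsts} {Q : EngConsts} {R : RenConsts} {β U μ : ℝ}

/-- **(E3a-MS) AT SCALE `n+1` FROM THE TERM TABLE.**  See the module docstring. -/
theorem twoLegSizesMST_succ_of_chain_table (hμ : μ ∈ klWindowC) {K : TrigPolyC4v} {Kp : ℕ → TrigPolyC4v}
    (hK : ∀ p : Fin 2 → ℝ, K.eval p = ∑ m ∈ range (nScales β + 1), (Kp m).eval p) {n : ℕ} (hn : n + 1 ≤ nScales β) (d : ℕ)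
    (hc₁ : Continuous (klLocalPart L M β U μ K (n + 1))) (hc₀ : Continuous (klLocalPart L M β U μ K n))
    {S : TrigPolyC4v} (hS : ∀ θ, klLocalPart L M β U μ K (n + 1) θ - klLocalPart L M β U μ K n θ = S.eval (klFermiPoint μ K θ))
    {a : ℕ → ℕ → ℝ} (ha : ∀ m ≤ nScales β, ∀ j ≤ 4, ∀ q : Momentum, ‖iteratedFDeriv ℝ j (evalM (Kp m)) q‖ ≤ a m j)
    {A : ℝ} (hA : ∀ j ≤ 2, chainSizeSum Kp a (n + 1) (nScales β) j ≤ A) (hA20 : A ≤ 1 / 20)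
    (hd : klCurveD ≤ (bandBounds (show (-4 : ℝ) < -1.1 by norm_num) (show (-1.1 : ℝ) ≤ -0.1 by norm_num)
      (show (-0.1 : ℝ) < 0 by norm_num)).Dtmin - 2 * A)
    (hlo : (-1.1 : ℝ) ≤ μ - A) (hhi : μ + A ≤ -0.1)
    {A₃ A₄ : ℝ} (hA₃ : chainSizeSum Kp a (n + 1) (nScales β) 3 ≤ A₃) (hA₄ : chainSizeSum Kp a (n + 1) (nScales β) 4 ≤ A₄)
    {Ms : ℕ → ℝ} (hMnn : ∀ k, 0 ≤ Ms k) (hM0 : ∀ q : Momentum, |evalM S q| ≤ Ms 0)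
    (hM : ∀ k, 1 ≤ k → k ≤ 5 → ∀ q : Momentum, ‖iteratedFDeriv ℝ k (evalM S) q‖ ≤ Ms k)
    {e : ℕ → ℕ → ℝ}
    (he : ∀ m ∈ Ioc (n + 1) (nScales β), ∀ j ≤ 4, ∀ q : Momentum, ‖iteratedFDeriv ℝ j (evalM (highPart d (Kp m))) q‖ ≤ e m j)
    {X : ℝ} (hX : ∀ l ≤ 4, ∀ x : ℝ, ‖iteratedFDeriv ℝ l salmhoferCutoff x‖ ≤ X)
    (hfit_n : ∀ j ≤ 4, (if j = 0 then Ms 0 else 0) +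
      (j.factorial : ℝ) ^ 2 * (2 * j.factorial * X * 200 ^ j) * bellCum Ms (msD A₃ A₄) j *
        (4 + max 1 (((j - 1).factorial : ℝ) / (8 / 5))) ^ j ≤ twoLegBar G Q U j (n + 1))
    (hfit_m : ∀ m ∈ Ioc (n + 1) (nScales β), ∀ j ≤ 4,
      (if j = 0 then Ms 1 * msdD A A₃ A₄ ((bandBounds (show (-4 : ℝ) < -1.1 by norm_num) (show (-1.1 : ℝ) ≤ -0.1 by norm_num)
        (show (-0.1 : ℝ) < 0 by norm_num)).Dtmin) (e m) 0 else 0) +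
      (j.factorial : ℝ) ^ 2 * (2 * j.factorial * X * 200 ^ j) *
        bellDiffCum Ms (msD A₃ A₄) (msdD A A₃ A₄ ((bandBounds (show (-4 : ℝ) < -1.1 by norm_num)
          (show (-1.1 : ℝ) ≤ -0.1 by norm_num) (show (-0.1 : ℝ) < 0 by norm_num)).Dtmin) (e m)) j *
        (4 + max 1 (((j - 1).factorial : ℝ) / (8 / 5))) ^ j ≤
        msBar G Q U (n + 1) * (R.Gfr j * uPow j U * (4 : ℝ) ^ (((j : ℤ) - 2) * m))) :
    TwoLegSizesMST L M G Q R β U μ K (n + 1) := by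
  set B := bandBounds (show (-4 : ℝ) < -1.1 by norm_num) (show (-1.1 : ℝ) ≤ -0.1 by norm_num) (show (-0.1 : ℝ) < 0 by norm_num)
    with hBdef
  have hC : ∀ k ≤ nScales β - (n + 1), ContDiff ℝ 4 (klFermiPoint μ (msChain d Kp (n + 1) (nScales β) k)) :=
    fun k hk => (chain_curve_sizes d hn ha hA hA20 hd hlo hhi hA₃ hA₄ hk 0).2.1
  have hGs := fun m j (hj : j ≤ 4) i (hi : i ≤ j) t =>
    msProfile_centred_sizes d hn ha hA hA20 hd hlo hhi hA₃ hA₄ S hMnn hM0 hM he m hj hi t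
  have hmean := abs_klAngularMean_msProfile_le d hn ha hA hA20 hd hlo hhi hA₃ hA₄ S hMnn hM0 hM he
  refine twoLegSizesMST_succ_of_chain_sizes hμ hK hn d hc₁ hc₀ hS hC hX
    (fun m j => msGs Ms A A₃ A₄ B.Dtmin e (n + 1) (nScales β) m j) hGs ?_ ?_
  · intro j hj
    refine le_trans ?_ (hfit_n j hj)
    have h1 : (if j = 0 then |klAngularMean (msProfile μ S d Kp (n + 1) (nScales β) (n + 1))| else 0) ≤
        (if j = 0 then Ms 0 else 0) := by
      split_ifs
      · simpa [msMean] using hmean (n + 1)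
      · exact le_rfl
    have h2 : msGs Ms A A₃ A₄ B.Dtmin e (n + 1) (nScales β) (n + 1) j = bellCum Ms (msD A₃ A₄) j := by simp [msGs]
    rw [h2]
    linarith
  · intro m hm j hj
    refine le_trans ?_ (hfit_m m hm j hj)
    have hne : m ≠ n + 1 := by have := (Finset.mem_Ioc.mp hm).1; omega
    have h1 : (if j = 0 then |klAngularMean (msProfile μ S d Kp (n + 1) (nScales β) m)| else 0) ≤
        (if j = 0 then Ms 1 * msdD A A₃ A₄ B.Dtmin (e m) 0 else 0) := by
      split_ifs
      · simpa [msMean, hne, hm] using hmean m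
      · exact le_rfl
    have h2 : msGs Ms A A₃ A₄ B.Dtmin e (n + 1) (nScales β) m j = bellDiffCum Ms (msD A₃ A₄) (msdD A A₃ A₄ B.Dtmin (e m)) j := by
      simp [msGs, hne, hm]
    rw [h2]
    linarith

end MS

end Summit.HubbardSuperconductivity.HubbardSuperconductivity.Theorems.KLRegimeSplit

end
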